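import Mathlib
import Summits.ValiantsHypothesis.ValiantsHypothesis.Theses.GirthSidon

/-!
# Route GirthSidon — item `MomentExponentsRelationFree` (the `B₃₀` property of the power-sum code)

Route `route-ValiantsHypothesis-GirthSidon`, item `stmt-ValiantsHypothesis-6542` (support).

For `m ≥ 60` the exponents `d(m,i) = ∑_{k<60} (i+1)^k · m^{60k}` (`i < m`) admit no additive
relation between two multisets of size `≤ 30`: if `S, T` are multisets over `Fin m` with
`card S, card T ≤ 30` and `∑_{i∈S} d(m,i) = ∑_{i∈T} d(m,i)`, then `S = T`.

Proof (as in the route thesis).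
* No carries: `∑_{i∈S} d(m,i) = ∑_{k<60} p_k(S) · (m^60)^k` with the power sums
  `p_k(S) = ∑_{i∈S} (i+1)^k ≤ 30 · m^59 < m^60`, so uniqueness of base-`m^60` digits
  (`girthSidon_baseDigits_eq_of_sum_eq`) gives `p_k(S) = p_k(T)` for all `k < 60`.
* Vandermonde: the union `U` of the supports has `≤ 60` elements, and
  `∑_{x∈U} (count x S − count x T) · (x+1)^k = 0` for all `k < 60 ≥ |U|`; since `x ↦ x+1` is
  injective, the nondegeneracy of the Vandermonde matrix
  (`Matrix.eq_zero_of_forall_pow_sum_mul_pow_eq_zero`) forces `count x S = count x T` on `U`,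
  hence everywhere, i.e. `S = T`.

Sources: the statement is elementary (Vandermonde / finite Hausdorff moment problem); it is the
`B_h`-set property used by the route (Raz 2010 programme, cf. Narayanan 2026).
-/

-- `Summit.<Summit>.<Problem>` repeats `ValiantsHypothesis` by the tree's layout convention (D-0017).
set_option linter.dupNamespace false

namespace Summit.ValiantsHypothesis.ValiantsHypothesis.Theorems

open Finset

/-- Vandermonde nondegeneracy over an arbitrary finite index type: if `f : ι → R` is injective
(`R` a domain) and `∑_j v j * f j ^ i = 0` for every `i < card ι`, then `v = 0`.
(Reindexing of `Matrix.eq_zero_of_forall_pow_sum_mul_pow_eq_zero` along `Fintype.equivFin`.) -/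
theorem girthSidon_eq_zero_of_forall_sum_mul_pow_eq_zero {ι R : Type*} [Fintype ι] [CommRing R]
    [IsDomain R] {f v : ι → R} (hf : Function.Injective f)
    (hfv : ∀ i < Fintype.card ι, ∑ j, v j * f j ^ i = 0) : v = 0 := by
  classical
  set e := Fintype.equivFin ι with he
  have key : (v ∘ e.symm) = 0 := by
    apply Matrix.eq_zero_of_forall_pow_sum_mul_pow_eq_zero (f := f ∘ e.symm)
    · exact hf.comp e.symm.injective
    · intro i
      rw [← hfv i i.isLt]
      exact Fintype.sum_equiv e.symm _ _ (fun j => rfl)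
  funext j
  have := congrFun key (e j)
  simpa using this

/-- Finset form of Vandermonde nondegeneracy: if `val` is injective, `U` is a finset and
`∑_{x∈U} c x * val x ^ i = 0` for all `i < |U|`, then `c` vanishes on `U`. -/
theorem girthSidon_eq_zero_on_finset_of_sum_mul_pow_eq_zero {α R : Type*} [CommRing R] [IsDomain R]
    (U : Finset α) {val : α → R} (c : α → R) (hval : Function.Injective val)
    (h : ∀ i < U.card, ∑ x ∈ U, c x * val x ^ i = 0) : ∀ x ∈ U, c x = 0 := by
  have key : (fun x : U => c x) = 0 := by
    apply girthSidon_eq_zero_of_forall_sum_mul_pow_eq_zero (f := fun x : U => val x)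
    · intro x y hxy
      exact Subtype.ext (hval hxy)
    · intro i hi
      rw [Fintype.card_coe] at hi
      rw [← h i hi]
      exact Finset.sum_coe_sort U (fun x => c x * val x ^ i)
  intro x hx
  exact congrFun key ⟨x, hx⟩

/-- Uniqueness of base-`M` digits: if `∑_{k<n} a k * M^k = ∑_{k<n} b k * M^k` with all digits
`a k, b k < M` (`k < n`), then `a k = b k` for all `k < n`. -/
theorem girthSidon_baseDigits_eq_of_sum_eq (M : ℕ) :
    ∀ (n : ℕ) (a b : ℕ → ℕ), (∀ k < n, a k < M) → (∀ k < n, b k < M) →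
      ∑ k ∈ range n, a k * M ^ k = ∑ k ∈ range n, b k * M ^ k → ∀ k < n, a k = b k := by
  intro n
  induction n with
  | zero => intro a b _ _ _ k hk; omega
  | succ n ih =>
    intro a b ha hb h
    have hsplit : ∀ c : ℕ → ℕ, ∑ k ∈ range (n + 1), c k * M ^ k
        = c 0 + M * ∑ k ∈ range n, c (k + 1) * M ^ k := by
      intro c
      rw [Finset.sum_range_succ', pow_zero, mul_one, add_comm, Finset.mul_sum]
      congr 1
      apply Finset.sum_congr rfl
      intro k _
      ring
    rw [hsplit a, hsplit b] at h
    have ha0 : a 0 < M := ha 0 (Nat.succ_pos n)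
    have hb0 : b 0 < M := hb 0 (Nat.succ_pos n)
    have hM : 0 < M := by omega
    have h0 : a 0 = b 0 := by
      have h1 : (a 0 + M * ∑ k ∈ range n, a (k + 1) * M ^ k) % M = a 0 := by
        rw [Nat.add_mul_mod_self_left, Nat.mod_eq_of_lt ha0]
      have h2 : (b 0 + M * ∑ k ∈ range n, b (k + 1) * M ^ k) % M = b 0 := by
        rw [Nat.add_mul_mod_self_left, Nat.mod_eq_of_lt hb0]
      rw [← h1, ← h2, h]
    have hrest : ∑ k ∈ range n, a (k + 1) * M ^ k = ∑ k ∈ range n, b (k + 1) * M ^ k := by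
      have h1 : (a 0 + M * ∑ k ∈ range n, a (k + 1) * M ^ k) / M
          = ∑ k ∈ range n, a (k + 1) * M ^ k := by
        rw [Nat.add_mul_div_left _ _ hM, Nat.div_eq_of_lt ha0, zero_add]
      have h2 : (b 0 + M * ∑ k ∈ range n, b (k + 1) * M ^ k) / M
          = ∑ k ∈ range n, b (k + 1) * M ^ k := by
        rw [Nat.add_mul_div_left _ _ hM, Nat.div_eq_of_lt hb0, zero_add]
      rw [← h1, ← h2, h]
    have ih' := ih (fun k => a (k + 1)) (fun k => b (k + 1)) (fun k hk => ha (k + 1) (by omega))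
      (fun k hk => hb (k + 1) (by omega)) hrest
    intro k hk
    rcases k with _ | k
    · exact h0
    · exact ih' k (by omega)

open Summit.ValiantsHypothesis.ValiantsHypothesis.Theses.GirthSidon in
/-- **`MomentExponentsRelationFree`** (route GirthSidon, item `stmt-ValiantsHypothesis-6542`):
for `m ≥ 60`, two multisets `S, T` over `Fin m` of size `≤ 30` with
`∑_{i∈S} ∑_{k<60} (i+1)^k m^{60k} = ∑_{i∈T} ∑_{k<60} (i+1)^k m^{60k}` are equal.
No carries in base `m^60` give equal power sums `p_k(S) = p_k(T)` (`k < 60`), and Vandermonde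
on the `≤ 60` values occurring in `S` or `T` gives equal multiplicities. -/
theorem momentExponentsRelationFree_proof :
    Summit.ValiantsHypothesis.ValiantsHypothesis.Theses.GirthSidon.MomentExponentsRelationFree := by
  unfold MomentExponentsRelationFree
  intro m hm S T hS hT hsum
  -- power sums of the values `i + 1`, `i ∈ A`
  set p : Multiset (Fin m) → ℕ → ℕ := fun A k => (A.map fun i : Fin m => ((i : ℕ) + 1) ^ k).sum
    with hp
  -- Step 1: the sums in base `m ^ 60`
  have hdigit : ∀ A : Multiset (Fin m),
      (A.map fun i : Fin m => ∑ k ∈ Finset.range 60, ((i : ℕ) + 1) ^ k * m ^ (60 * k)).sum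
        = ∑ k ∈ Finset.range 60, p A k * (m ^ 60) ^ k := by
    intro A
    rw [Multiset.sum_map_sum]
    apply Finset.sum_congr rfl
    intro k _
    rw [hp, Multiset.sum_map_mul_right, pow_mul]
  -- Step 2: the digits are `< m ^ 60` (no carries)
  have hbound : ∀ A : Multiset (Fin m), Multiset.card A ≤ 30 → ∀ k < 60, p A k < m ^ 60 := by
    intro A hA k hk
    have h1 : p A k ≤ Multiset.card A * m ^ k := by
      have h2 := Multiset.sum_le_card_nsmul (A.map fun i : Fin m => ((i : ℕ) + 1) ^ k) (m ^ k)
        (by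
          intro x hx
          rw [Multiset.mem_map] at hx
          obtain ⟨i, _, rfl⟩ := hx
          exact Nat.pow_le_pow_left i.isLt k)
      simpa [hp] using h2
    have h30 : 30 < m := by omega
    have hpos : 0 < m ^ 59 := pow_pos (by omega) 59
    calc p A k ≤ Multiset.card A * m ^ k := h1
      _ ≤ 30 * m ^ 59 := Nat.mul_le_mul hA (Nat.pow_le_pow_right (by omega) (by omega))
      _ < m * m ^ 59 := Nat.mul_lt_mul_of_pos_right h30 hpos
      _ = m ^ 60 := by ring
  -- Step 3: equal power sums `p S k = p T k` for `k < 60`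
  have hps : ∀ k < 60, p S k = p T k := by
    rw [hdigit S, hdigit T] at hsum
    exact girthSidon_baseDigits_eq_of_sum_eq (m ^ 60) 60 (p S) (p T) (hbound S hS) (hbound T hT)
      hsum
  -- Step 4: Vandermonde on the union of the supports
  classical
  set U : Finset (Fin m) := S.toFinset ∪ T.toFinset with hU
  have hUcard : U.card ≤ 60 := by
    calc U.card ≤ S.toFinset.card + T.toFinset.card := Finset.card_union_le _ _
      _ ≤ Multiset.card S + Multiset.card T :=
          Nat.add_le_add (Multiset.toFinset_card_le S) (Multiset.toFinset_card_le T)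
      _ ≤ 60 := by omega
  have hpU : ∀ A : Multiset (Fin m), A.toFinset ⊆ U → ∀ k,
      (p A k : ℤ) = ∑ x ∈ U, (A.count x : ℤ) * (((x : ℕ) : ℤ) + 1) ^ k := by
    intro A hA k
    rw [hp]
    simp only
    rw [Finset.sum_multiset_map_count, Finset.sum_subset hA]
    · push_cast
      apply Finset.sum_congr rfl
      intro x _
      simp
    · intro x _ hx
      rw [Multiset.mem_toFinset] at hx
      simp [Multiset.count_eq_zero.mpr hx]
  have hc : ∀ x ∈ U, ((S.count x : ℤ) - (T.count x : ℤ)) = 0 := by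
    apply girthSidon_eq_zero_on_finset_of_sum_mul_pow_eq_zero U
      (val := fun x : Fin m => (((x : ℕ) : ℤ) + 1)) (fun x => (S.count x : ℤ) - (T.count x : ℤ))
    · intro x y hxy
      apply Fin.ext
      have : ((x : ℕ) : ℤ) = ((y : ℕ) : ℤ) := by simpa using hxy
      exact_mod_cast this
    · intro i hi
      have hi60 : i < 60 := lt_of_lt_of_le hi hUcard
      have h1 := hpU S (by rw [hU]; exact Finset.subset_union_left) i
      have h2 := hpU T (by rw [hU]; exact Finset.subset_union_right) i
      have h3 : (p S i : ℤ) = (p T i : ℤ) := by exact_mod_cast hps i hi60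
      simp only [sub_mul, Finset.sum_sub_distrib, ← h1, ← h2, h3, sub_self]
  ext x
  by_cases hx : x ∈ U
  · have := hc x hx
    omega
  · rw [hU, Finset.mem_union, Multiset.mem_toFinset, Multiset.mem_toFinset, not_or] at hx
    rw [Multiset.count_eq_zero.mpr hx.1, Multiset.count_eq_zero.mpr hx.2]

end Summit.ValiantsHypothesis.ValiantsHypothesis.Theorems
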